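import Summits.BirchSwinnertonDyer.BirchSwinnertonDyer.Theorems.GenusKolyvaginAtTwoPowDvdShaCardAtTwoRTLocalDegreeQuadratic
import Summits.BirchSwinnertonDyer.BirchSwinnertonDyer.Theorems.GenusKolyvaginAtTwoPowDvdShaCardAtTwoRTLocalKernelSplit
import Literature.NumberTheory.EllipticCurves.LocalRestrictionUnramifiedDescentProofs
import Literature.NumberTheory.EllipticCurves.ArtinFormalismQuadraticLocalProofs
import Literature.NumberTheory.Automorphic.QuadraticBaseChangeFrobCompatibleAuxFieldProofs
import Literature.NumberTheory.QuadraticFields.HeegnerCondition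
import HarnessLib

/-!
# Route `GenusKolyvaginAtTwo`, LINE 18 / LINE 19 (L_T stmt-BirchSwinnertonDyer-23242, L⁺_T stmt-23379): the `d_K`-relaxation
# is EMPTY away from `d_K` — at every prime `p ∤ d_K` of good reduction (split OR inert, `p = 2` included) and at every split
# prime (any reduction), the `K_w`-local and `ℚ_p`-local conditions of a quadratic field `K` with odd `d_K` coincide

Seat `bsd-line-gk2-p3` g17 (cell `bsd-f1-sign2`), `--supports stmt-BirchSwinnertonDyer-23242` (helper; closes nothing).
THEOREMS ONLY (no definition, no named fact, no `sorry`); BSD is not proved by any of this.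

With `…RTLocalKernelRelaxationIndex` / `…RTLocalDegreeQuadratic` (index `≤ #E(ℚ_p)[2]` at the odd ramified `p ∣ d_K`) this
completes the LINE 18/19 local dictionary of critic #179's «genus budget» for the Heegner field, place by place, in the
currency the skeletons quantify over (`[K : ℚ] = 2`, `Odd d_K`, primes `p`, `Matsuno2009.primePlace p`, `w ∣ p`):

* §1 quadratic fields: `exists_eq_add_mul_of_not_mem_range` (`K = ℚ + ℚθ` for any `θ ∉ ℚ`); `discr_eq_four_mul_add_one_of_odd`
  (`d_K ≡ 1 (mod 4)` for odd `d_K`, Stickelberger); `intCast_not_mem_primesAbove_of_not_dvd`;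
  `isUnramifiedIn_primePlace_of_not_dvd_discr` — **`p ∤ d_K` (odd `d_K`) ⟹ `p` unramified in `K`**, `p = 2` included, from the
  tree's `isUnramifiedIn_of_sq_eq_intCast` (`K = ℚ(√d_K)`, `d_K ≡ 1 (4)`); `ramificationIdx_mul_inertiaDeg_eq_one_of_ncard_primesOver_eq_two`
  and `finrank_adicCompletion_primePlace_eq_one_of_ncard_eq_two` — **at a split prime `[K_w : ℚ_p] = 1`**.
* §2 `localRestrictionKer_adicCompletion_eq_of_not_dvd_discr` — **unramified good places**: `[K:ℚ] = 2`, `Odd d_K`, `p ∤ d_K`,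
  `E` good at `p`, `w ∣ p` ⟹ `ker(H¹(ℚ,E) → H¹(K_w,E)) = ker(H¹(ℚ,E) → H¹(ℚ_p,E))` (Milne *ADT* I Prop. 3.8 through the tree's
  `mem_localRestrictionKer_adicCompletion_of_isUnramifiedIn`), and `selmerLocalKer_adicCompletion_eq_of_not_dvd_discr` (every level
  `n`); `localKernel_primePlace_eq_bot_of_ncard_primesOver_eq_two` / `selmerLocalKer_adicCompletion_eq_of_ncard_primesOver_eq_two`
  — **split places, any reduction** (`[K_w : ℚ_p] = 1` and g16's `localKernel_eq_bot_of_finrank_eq_one`).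

So for the Heegner field of the GK2 habitat (Heegner hypothesis: every `p ∣ N` splits; `d_K` odd) the relaxed-vs-strict index is
`1` at every finite place off `d_K` and `≤ 2^{i_p}` at `p ∣ d_K` — the abstract bookkeeping `relIndex_inf_iInf_le_prod` then bounds a
`d_K`-relaxed Selmer group over the strict one by `2^{Σ_{p ∣ d_K} i_p}`.

References: [MilneADT2006] I Prop. 3.8; [DokchitserDokchitserAnnals2010] Lemma 4.14 (proof); [NeukirchANT1999] Ch. I §8, Ch. II
(8.5); Marcus, *Number Fields*, Ch. 2 Thm. 1, Ch. 3 Thm. 25; [Kramer1981] §2 Prop. 3.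
-/

set_option autoImplicit false
-- the Theorems namespace of this sub repeats the summit name by design (D-0017 nested layout)
set_option linter.dupNamespace false

noncomputable section

open scoped Classical

namespace Summit.BirchSwinnertonDyer.BirchSwinnertonDyer.Theorems.GenusExact.PlusDescent

open WeierstrassCurve NumberField IsDedekindDomain Literature.NumberTheory.EllipticCurves
  Literature.Barriers.BirchSwinnertonDyer Literature.NumberTheory.GaloisRepresentations

/-! ## §1 Quadratic fields: `K = ℚ + ℚθ`, `d_K ≡ 1 (4)`, unramified off `d_K`, local degree `1` at split primes -/

section QuadraticField

variable {K : Type} [Field K] [NumberField K]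

/-- **`K = ℚ + ℚ θ`** for `[K : ℚ] = 2` and any `θ ∈ K ∖ ℚ`: `1, θ` are linearly independent, hence a basis.
Marcus, *Number Fields*, Ch. 2. [folklore] -/
theorem exists_eq_add_mul_of_not_mem_range (h2 : Module.finrank ℚ K = 2) {θ : K}
    (hθ : θ ∉ Set.range (algebraMap ℚ K)) (x : K) :
    ∃ a b : ℚ, x = algebraMap ℚ K a + algebraMap ℚ K b * θ := by
  haveI : Module.Finite ℚ K := Module.finite_of_finrank_pos (by omega)
  have hli : LinearIndependent ℚ ![(1 : K), θ] := by
    refine LinearIndependent.pair_iff.mpr fun s t hst ↦ ?_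
    by_cases ht : t = 0
    · subst ht
      simp only [zero_smul, add_zero, smul_eq_zero, one_ne_zero, or_false] at hst
      exact ⟨hst, rfl⟩
    · exfalso
      apply hθ
      refine ⟨-s / t, ?_⟩
      rw [Algebra.smul_def, Algebra.smul_def, mul_one] at hst
      rw [map_div₀, map_neg, div_eq_iff ((map_ne_zero (algebraMap ℚ K)).mpr ht), neg_eq_iff_add_eq_zero,
        mul_comm]
      exact hst
  have hsp := hli.span_eq_top_of_card_eq_finrank' (by simp [h2])
  have hx : x ∈ Submodule.span ℚ (Set.range ![(1 : K), θ]) := by rw [hsp]; exact Submodule.mem_top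
  rw [Matrix.range_cons, Matrix.range_cons, Matrix.range_empty, Set.union_empty, Set.union_singleton,
    Submodule.mem_span_pair] at hx
  obtain ⟨a, b, hab⟩ := hx
  refine ⟨b, a, ?_⟩
  rw [← hab, Algebra.smul_def, Algebra.smul_def, mul_one, add_comm]

/-- **`d_K = 4k + 1` for a quadratic field with odd discriminant** (Stickelberger: `d_K ≡ 0, 1 (mod 4)`, tree
`QuadraticFields.Quadratic.discr_emod_four`). [folklore] -/
theorem discr_eq_four_mul_add_one_of_odd (h2 : Module.finrank ℚ K = 2) (hodd : Odd (NumberField.discr K)) :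
    ∃ k : ℤ, NumberField.discr K = 4 * k + 1 := by
  rcases Literature.NumberTheory.QuadraticFields.Quadratic.discr_emod_four (K := K) h2 with h0 | h1
  · exfalso
    obtain ⟨r, hr⟩ := hodd
    omega
  · exact ⟨NumberField.discr K / 4, by omega⟩

/-- An integer prime to `p` lies in no prime of `\bar ℤ` above the place of `ℚ` at `p` (it would lie in that place's
prime of `𝓞 ℚ`, which contains `p`: Bézout). [folklore] -/
theorem intCast_not_mem_primesAbove_of_not_dvd {p : ℕ} (hp : p.Prime) {d : ℤ} (hpd : ¬ (p : ℤ) ∣ d)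
    {𝔓 : Ideal (absIntegers (𝓞 ℚ) ℚ)} (h𝔓 : 𝔓 ∈ (Matsuno2009.primePlace p).primesAbove) :
    ((d : absIntegers (𝓞 ℚ) ℚ)) ∉ 𝔓 := by
  intro hd
  have hd' : (d : 𝓞 ℚ) ∈ (Matsuno2009.primePlace p).asIdeal := by
    have h : 𝔓.comap (algebraMap (𝓞 ℚ) (absIntegers (𝓞 ℚ) ℚ)) = (Matsuno2009.primePlace p).asIdeal :=
      h𝔓.2.over.symm
    rw [← h, Ideal.mem_comap, map_intCast]
    exact hd
  have hcop : IsCoprime (p : ℤ) d := by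
    rw [Int.isCoprime_iff_gcd_eq_one, Int.gcd_eq_natAbs, Int.natAbs_natCast]
    exact hp.coprime_iff_not_dvd.mpr fun h ↦ hpd (Int.natCast_dvd.mpr h)
  obtain ⟨a, b, hab⟩ := hcop
  have h1 : (1 : 𝓞 ℚ) ∈ (Matsuno2009.primePlace p).asIdeal := by
    have hcast := congrArg (Int.cast : ℤ → 𝓞 ℚ) hab
    push_cast at hcast
    rw [← hcast]
    exact Ideal.add_mem _ (Ideal.mul_mem_left _ _ (Matsuno2009.natCast_mem_primePlace hp))
      (Ideal.mul_mem_left _ _ hd')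
  exact (Matsuno2009.primePlace p).isPrime.ne_top ((Ideal.eq_top_iff_one _).mpr h1)

/-- **`p ∤ d_K` ⟹ `p` is unramified in the quadratic field `K`** (`d_K` odd; `p = 2` allowed): `K = ℚ(√d_K)` with
`d_K ≡ 1 (mod 4)`, and the tree's `isUnramifiedIn_of_sq_eq_intCast` (the inertia groups above `p` fix `√d_K`).
Marcus, *Number Fields*, Ch. 3 Thm. 25; Neukirch Ch. I §8. [folklore] -/
theorem isUnramifiedIn_primePlace_of_not_dvd_discr (h2 : Module.finrank ℚ K = 2) (hodd : Odd (NumberField.discr K))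
    {p : ℕ} (hp : p.Prime) (hpd : ¬ (p : ℤ) ∣ NumberField.discr K) :
    Algebra.IsUnramifiedIn (𝓞 K) (Matsuno2009.primePlace p).asIdeal := by
  obtain ⟨θ, hθQ, hθ⟩ := exists_sq_eq_discr_not_mem_range K h2
  obtain ⟨k, hk⟩ := discr_eq_four_mul_add_one_of_odd h2 hodd
  have hθ' : θ ^ 2 = ((NumberField.discr K : ℤ) : K) := by rw [hθ, map_intCast]
  exact isUnramifiedIn_of_sq_eq_intCast K h2 hθQ hk hθ' (Matsuno2009.primePlace p)
    fun 𝔓 h𝔓 ↦ intCast_not_mem_primesAbove_of_not_dvd hp hpd h𝔓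

/-- **`e(𝔭|p) f(𝔭|p) = 1` at a split prime of a quadratic field**: `[K : ℚ] = 2`, `#{𝔭 ∣ p} = 2`, `𝔭 ∣ p` ⟹
`e(𝔭|ℤ) · f(𝔭|ℤ) = 1` (`Σ_{𝔭 ∣ p} e f = 2` over two primes, each term `≥ 1`). Marcus, *Number Fields*, Ch. 3 Thm. 21.
[folklore] -/
theorem ramificationIdx_mul_inertiaDeg_eq_one_of_ncard_primesOver_eq_two (h2 : Module.finrank ℚ K = 2) {p : ℕ}
    (hp : p.Prime) (hsplit : ((Ideal.span {(p : ℤ)}).primesOver (𝓞 K)).ncard = 2)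
    (P : Ideal (𝓞 K)) [P.IsPrime] [hP : P.LiesOver (Ideal.span {(p : ℤ)})] :
    P.ramificationIdx ℤ * P.inertiaDeg ℤ = 1 := by
  haveI hprime : (Ideal.span {(p : ℤ)}).IsPrime :=
    (Ideal.span_singleton_prime (by exact_mod_cast hp.ne_zero)).mpr (Nat.prime_iff_prime_int.mp hp)
  haveI : (Ideal.span {(p : ℤ)}).IsMaximal :=
    hprime.isMaximal (by rw [Ne, Ideal.span_singleton_eq_bot]; exact_mod_cast hp.ne_zero)
  set S := (Ideal.span {(p : ℤ)}).primesOver (𝓞 K) with hSdef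
  have hsum := Ideal.sum_ramification_inertia_eq_finrank (Ideal.span {(p : ℤ)}) (𝓞 K)
  rw [RingOfIntegers.rank, h2] at hsum
  have hmem : P ∈ S := ⟨inferInstance, hP⟩
  have hpos : ∀ q : S, 1 ≤ q.1.ramificationIdx ℤ * q.1.inertiaDeg ℤ := by
    intro q
    haveI : q.1.IsPrime := q.2.1
    exact Nat.one_le_iff_ne_zero.mpr (mul_ne_zero (Ideal.ramificationIdx_pos q.1 ℤ).ne' (Ideal.inertiaDeg_pos q.1 ℤ).ne')
  have hcard : Fintype.card S = 2 := by
    rw [← Nat.card_eq_fintype_card, Nat.card_coe_set_eq]; exact hsplit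
  -- `Σ = 2` over `2` terms each `≥ 1` forces every term to be `1`
  have hle : ∑ q : S, q.1.ramificationIdx ℤ * q.1.inertiaDeg ℤ ≥
      (P.ramificationIdx ℤ * P.inertiaDeg ℤ) + ((Finset.univ : Finset S).erase ⟨P, hmem⟩).card • 1 := by
    rw [← Finset.add_sum_erase _ _ (Finset.mem_univ (⟨P, hmem⟩ : S))]
    exact Nat.add_le_add_left (Finset.card_nsmul_le_sum _ _ 1 fun q _ ↦ hpos q) _
  rw [Finset.card_erase_of_mem (Finset.mem_univ _), Finset.card_univ, hcard, hsum, smul_eq_mul, mul_one] at hle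
  have h1 := hpos ⟨P, hmem⟩
  simp only at h1
  omega

variable {p : ℕ} (w : HeightOneSpectrum (𝓞 K)) [w.asIdeal.LiesOver (Matsuno2009.primePlace p).asIdeal]

/-- **`[K_w : ℚ_p] = 1` at a split prime of a quadratic field** (`#{𝔭 ∣ p} = 2`), for Matsuno's structure map
(`finrank_adicCompletionMap_eq_ramificationIdx_mul_inertiaDeg`). [cite: NeukirchANT1999, Ch. II Prop. (8.5)] -/
theorem finrank_adicCompletion_primePlace_eq_one_of_ncard_eq_two (h2 : Module.finrank ℚ K = 2) (hp : p.Prime)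
    (hsplit : ((Ideal.span {(p : ℤ)}).primesOver (𝓞 K)).ncard = 2) :
    letI : Algebra ((Matsuno2009.primePlace p).adicCompletion ℚ) (w.adicCompletion K) :=
      (Literature.NumberTheory.EllipticCurves.adicCompletionMap (K := ℚ) K (Matsuno2009.primePlace p) w).toAlgebra
    Module.finrank ((Matsuno2009.primePlace p).adicCompletion ℚ) (w.adicCompletion K) = 1 := by
  haveI := Matsuno2009.liesOver_span_of_liesOver_primePlace K hp w
  haveI : w.asIdeal.IsPrime := w.isPrime
  have h := finrank_adicCompletionMap_eq_ramificationIdx_mul_inertiaDeg K (Matsuno2009.primePlace p) w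
  rw [ramificationIdx_mul_inertiaDeg_eq_one_of_ncard_primesOver_eq_two h2 hp hsplit w.asIdeal] at h
  exact h

end QuadraticField

/-! ## §2 The `K_w`-local and `ℚ_p`-local conditions coincide off `d_K` -/

section Heegner

variable (E : WeierstrassCurve ℚ) [E.IsElliptic] (K : Type) [Field K] [NumberField K] {p : ℕ}
  (w : HeightOneSpectrum (𝓞 K)) [w.asIdeal.LiesOver (Matsuno2009.primePlace p).asIdeal]

/-- **Unramified places of good reduction: the `d_K`-relaxation is empty** (Milne *ADT* I Prop. 3.8). For `E/ℚ` elliptic,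
`K` quadratic with odd `d_K`, a prime `p ∤ d_K` (so `p` is unramified in `K`; `p = 2` allowed) at which `E` has good reduction,
and `w ∣ p`: a class of `H¹(ℚ, E)` dies in `H¹(K_w, E)` iff it dies in `H¹(ℚ_p, E)` — the tree's
`mem_localRestrictionKer_adicCompletion_of_isUnramifiedIn` (inertia above `p` fixes every copy of `K_w`; unramified classes
vanish at good reduction, `Milne2006_unramifiedClass_eq_zero_holds`) with `K = ℚ + ℚ√d_K`, and the tower inclusion
`localRestrictionKer_le_of_tower`. [cite: MilneADT2006, Ch. I Prop. 3.8] [cite: DokchitserDokchitserAnnals2010, Lemma 4.14 (proof)] -/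
theorem localRestrictionKer_adicCompletion_eq_of_not_dvd_discr (h2 : Module.finrank ℚ K = 2)
    (hodd : Odd (NumberField.discr K)) (hp : p.Prime) (hpd : ¬ (p : ℤ) ∣ NumberField.discr K)
    (hgood : E.HasGoodReductionAt (Matsuno2009.primePlace p)) :
    E.localRestrictionKer (w.adicCompletion K) = E.localRestrictionKer ((Matsuno2009.primePlace p).adicCompletion ℚ) := by
  letI : Algebra ((Matsuno2009.primePlace p).adicCompletion ℚ) (w.adicCompletion K) :=
    (Literature.NumberTheory.EllipticCurves.adicCompletionMap (K := ℚ) K (Matsuno2009.primePlace p) w).toAlgebra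
  haveI : IsScalarTower ℚ ((Matsuno2009.primePlace p).adicCompletion ℚ) (w.adicCompletion K) :=
    IsScalarTower.of_algebraMap_eq fun x ↦
      (Literature.NumberTheory.EllipticCurves.adicCompletionMap_coe (K := ℚ) K (Matsuno2009.primePlace p) w x).symm
  haveI : Algebra.IsQuadraticExtension ℚ K := ⟨h2⟩
  haveI : IsGalois ℚ K := inferInstance
  obtain ⟨θ, hθQ, hθ⟩ := exists_sq_eq_discr_not_mem_range K h2
  refine le_antisymm (fun x hx ↦ ?_) (localRestrictionKer_le_of_tower E)
  exact mem_localRestrictionKer_adicCompletion_of_isUnramifiedIn E K hθ (exists_eq_add_mul_of_not_mem_range h2 hθQ)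
    hgood (isUnramifiedIn_primePlace_of_not_dvd_discr h2 hodd hp hpd) w hx

/-- **Level `n`: at an unramified good prime the Selmer condition at `w` IS the Selmer condition at `p`** — the
`d_K`-relaxed local condition of the (+)-descent coincides with the strict one at every `p ∤ d_K` of good reduction
(`localRestrictionKer_adicCompletion_eq_of_not_dvd_discr` read through `H¹(ℚ, E[n]) → H¹(ℚ, E)`).
[cite: MilneADT2006, Ch. I Prop. 3.8] [cite: SilvermanAEC2009, X.§4 (local conditions)] -/
theorem selmerLocalKer_adicCompletion_eq_of_not_dvd_discr (h2 : Module.finrank ℚ K = 2)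
    (hodd : Odd (NumberField.discr K)) (hp : p.Prime) (hpd : ¬ (p : ℤ) ∣ NumberField.discr K)
    (hgood : E.HasGoodReductionAt (Matsuno2009.primePlace p)) (n : ℤ) :
    selmerLocalKer E (w.adicCompletion K) n = selmerLocalKer E ((Matsuno2009.primePlace p).adicCompletion ℚ) n := by
  ext c
  rw [WeierstrassCurve.mem_selmerLocalKer_iff_torsionH1ToH1_mem,
    WeierstrassCurve.mem_selmerLocalKer_iff_torsionH1ToH1_mem,
    localRestrictionKer_adicCompletion_eq_of_not_dvd_discr E K w h2 hodd hp hpd hgood]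

omit [E.IsElliptic] in
/-- **Split places: `W_{p,K} = 0`** for `[K : ℚ] = 2` and a prime `p` with `#{𝔭 ∣ p} = 2` (ANY reduction of `E` at `p`;
e.g. every `p ∣ N` under the Heegner hypothesis): `[K_w : ℚ_p] = 1` and g16's `localKernel_eq_bot_of_finrank_eq_one`.
[cite: Matsuno2009, §3 (p. 451, W_{v,K})] [cite: DokchitserDokchitserAnnals2010, Lemma 4.14 (proof)] -/
theorem localKernel_primePlace_eq_bot_of_ncard_primesOver_eq_two (h2 : Module.finrank ℚ K = 2) (hp : p.Prime)
    (hsplit : ((Ideal.span {(p : ℤ)}).primesOver (𝓞 K)).ncard = 2) :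
    Matsuno2009.localKernel E K (Matsuno2009.primePlace p) w = ⊥ :=
  localKernel_eq_bot_of_finrank_eq_one E K (Matsuno2009.primePlace p) w
    (finrank_adicCompletion_primePlace_eq_one_of_ncard_eq_two w h2 hp hsplit)

omit [E.IsElliptic] in
/-- **Level `n` at a split place: the Selmer condition at `w` IS the Selmer condition at `p`** (any reduction).
[cite: Matsuno2009, §3 (p. 451, W_{v,K})] [cite: SilvermanAEC2009, X.§4 (local conditions)] -/
theorem selmerLocalKer_adicCompletion_eq_of_ncard_primesOver_eq_two (h2 : Module.finrank ℚ K = 2) (hp : p.Prime)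
    (hsplit : ((Ideal.span {(p : ℤ)}).primesOver (𝓞 K)).ncard = 2) (n : ℤ) :
    selmerLocalKer E (w.adicCompletion K) n = selmerLocalKer E ((Matsuno2009.primePlace p).adicCompletion ℚ) n :=
  selmerLocalKer_adicCompletion_eq_of_localKernel_eq_bot E K (Matsuno2009.primePlace p) w
    (localKernel_primePlace_eq_bot_of_ncard_primesOver_eq_two E K w h2 hp hsplit) n

end Heegner

end Summit.BirchSwinnertonDyer.BirchSwinnertonDyer.Theorems.GenusExact.PlusDescent

end
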